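import Summits.PneNP.GCT.Max.KYCannotSeparatePaddedPerFiveFromSix
import HarnessLib
import HarnessLib.Audit

/-!
# `GCT/Max`: `m ≤ 5` — plain Koszul–Young flattenings never separate the padded permanent `X₀₀^{n-m}·per_m` from `det_n` (`n ≥ m+1`)
# (cell `pub-gct-max`, track F; theory-2 memo `FINDINGS-LT2.md` §2–§3: conjecture C-F-2 PROVED for every `m ≤ 5`)

Conjecture C-F-2 of the memo (pre-registered, theory-2 gen 27): for every `m ≥ 2` and every `n ≥ m+1`, `rank KY_{p,k}(X₀₀^{n−m}·per_m) ≤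
rank KY_{p,k}(det_n)` for all `(p,k)` — the plain Koszul–Young flattenings `Λ^p ⊗ S^k` ([LandsbergGCT2017] §8.2.1) are blind to the padded permanent
on the whole padded family.  This module assembles the case `m ≤ 5` from the tree: `m = 5` (`Max/KYCannotSeparatePaddedPerFiveFromSix.lean`),
`m = 4` (`Max/KYCannotSeparatePaddedPerFourFromFive.lean`), `m = 3` (N-F-1, `Max/KYCannotSeparatePaddedPerThreeAtFour.lean`), every `(m,n)` with
`3m+2 ≤ 2n` (`Max/KYSharperEveryM.lean`), and the two tiny sizes that none of these covers, `(m,n) = (2,3)` (seven failing one-family cells `k = 1`,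
`2 ≤ c ≤ 8`, closed by the row-major histogram `κ₁(3,1)` of `Max/DetKYLeadingTermsTwoHist.lean`) and `(1,2)` (one-family table), proved here.
From `m = 6` on the edge `n = m+1` escapes the leading-term device (`(6,7)`: best order found gives target/bound `0.968⁻¹`, memo §2), so C-F-2 for
`m ≥ 6` needs more than leading terms; `m = 6, 7, 8` from `n = m+2` and `m = 9` from `n = 12` are certified numerically (memo §2) but not in Lean.

HONEST FRAMING: a LOCATED NEGATIVE about ONE family of equations for the padded permanents of size `≤ 5`, at every size of the padded family;
throughout the band `m+1 ≤ n < m²/2` separation is KNOWN in print ([LandsbergManivelRessayre2013] Thm. 1.0.1), so this is a statement about the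
instrument, not about `per` versus `det`; it says nothing about other Young flattenings, border apolarity or multiplicity obstructions, nor about
`dc(per_m)`, VP vs VNP or P vs NP; occurrence obstructions are ruled out in print (BIP'16); no census row moves.  References: [LandsbergGCT2017] §8.2.1;
[EfremenkoLandsbergSchenckWeyman2018] §1.1 (the printed no-go is for the Hilbert flattening at `n > 2m²+2m`).  Theory-2 gen 28. [folklore]
-/

open Finset

namespace Summit.PneNP.GCT

open Literature.Computability.AlgebraicComplexity Literature.Barriers.ValiantsHypothesis

namespace KYCellsLT2

open DetKYLeadingTerms DetKYLeadingTermsTwo KYAllM KYKOneExact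

/-! ## `(m,n) = (2,3)`: the column `k = 1` by the row-major histogram `κ₁(3,1)`, `k = 0` by the one-family test -/

/-- `κ₁(3,1)` (row-major order `σ = 1`, rank function `id`; nine pairs of three witness families; kernel). [folklore] -/
theorem hist_3_1 : totHist 3 1 id = [-4, 9, 2, -11, 1, -3, 5, 1, 9, 0] := by
  decide +kernel

/-- Column `k = 1` of `det₃` against the padded-`per₂` targets, all `c ≤ 8` (kernel). [folklore] -/
theorem col_3_1 : ∀ c : ℕ, c ≤ 8 →
    ((min (chooseSqSumD 2 1 * binomD (3 * 3) (c + 1)) (chooseSqSumD 2 (1 + 1) * binomD (3 * 3) c) : ℕ) : ℤ) ≤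
      ∑ a ∈ range (3 * 3 + 1), vget [-4, 9, 2, -11, 1, -3, 5, 1, 9, 0] a * binFac 3 a (3 * 3 - 1 - c) := by
  decide +kernel

/-- Column `k = 0` of `(2,3)` passes the one-family test (kernel). [folklore] -/
theorem table_2_3_k0 : ∀ c : ℕ, c ≤ 8 → kCell 2 3 c 0 = true := by
  decide +kernel

/-- Every primal cell at `(2,3)` has its determinant-side bound. [folklore] -/
theorem cells_2_3 (c k : ℕ) (hk : 2 * k + 1 ≤ 3) (hc : c + 1 ≤ 3 * 3) :
    min (chooseSqSum 2 k * (3 * 3).choose (c + 1)) (chooseSqSum 2 (k + 1) * (3 * 3).choose c) ≤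
      kyRank ℂ (3 * 3 - 1 - c) k (detPoly (Fin 3) ℂ) := by
  have hk' : k ≤ 1 := by omega
  interval_cases k
  · exact detBound_of_kCell 2 3 c 0 hk hc (table_2_3_k0 c (by omega))
  · refine detBound_of_lt2 2 3 c 1 1 hc ?_
    rw [lt2IEFast_eq_histSum 3 1 (rk := id) (fun _ => rfl), hist_3_1, ← chooseSqSumD_eq, ← chooseSqSumD_eq, ← binomD_eq,
      ← binomD_eq]
    exact col_3_1 c (by omega)

/-- `(m,n) = (2,3)`. [folklore] -/
theorem kyRank_paddedPerTwo_le_detThree (p k : ℕ) :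
    kyRank ℂ p k (paddedPerPoly ℂ 2 3) ≤ kyRank ℂ p k (detPoly (Fin 3) ℂ) :=
  kyRank_le_of_detBounds 2 3 (by norm_num) cells_2_3 p k

/-! ## `(m,n) = (1,2)`: the one-family test -/

/-- At `(1,2)` every primal cell (`k = 0`, `c ≤ 3`) passes the one-family test (kernel). [folklore] -/
theorem table_1_2 : ∀ c : ℕ, c ≤ 3 → kCell 1 2 c 0 = true := by
  decide +kernel

/-- Every primal cell at `(1,2)` has its determinant-side bound. [folklore] -/
theorem cells_1_2 (c k : ℕ) (hk : 2 * k + 1 ≤ 2) (hc : c + 1 ≤ 2 * 2) :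
    min (chooseSqSum 1 k * (2 * 2).choose (c + 1)) (chooseSqSum 1 (k + 1) * (2 * 2).choose c) ≤
      kyRank ℂ (2 * 2 - 1 - c) k (detPoly (Fin 2) ℂ) := by
  obtain rfl : k = 0 := by omega
  exact detBound_of_kCell 1 2 c 0 hk hc (table_1_2 c (by omega))

/-- `(m,n) = (1,2)`. [folklore] -/
theorem kyRank_paddedPerOne_le_detTwo (p k : ℕ) :
    kyRank ℂ p k (paddedPerPoly ℂ 1 2) ≤ kyRank ℂ p k (detPoly (Fin 2) ℂ) :=
  kyRank_le_of_detBounds 1 2 (by norm_num) cells_1_2 p k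

end KYCellsLT2

/-- `GCT/Max` node **KYCannotSeparatePaddedPerUpToFive** (conjecture C-F-2 of theory-2's memo for `m ≤ 5`): for every `m ≤ 5`, every
`n ≥ m+1` and every `(p,k)`, `rank KY_{p,k}(X₀₀^{n-m}·per_m) ≤ rank KY_{p,k}(det_n)` over `ℂ` — plain Koszul–Young flattenings are silent on the
padded permanents of size at most five at every size of the padded family.  A statement of the cell (LOCATED NEGATIVE on one instrument), PROVED
below from the tree's `m = 3, 4, 5` nodes, the every-`m` sharper-padding ceiling and two tiny tables. [folklore] -/
def KYCannotSeparatePaddedPerUpToFive : Prop :=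
  ∀ (m n : ℕ) [NeZero n], m ≤ 5 → m + 1 ≤ n → ∀ p k : ℕ,
    kyRank ℂ p k (paddedPerPoly ℂ m n) ≤ kyRank ℂ p k (detPoly (Fin n) ℂ)

/-- `KYCannotSeparatePaddedPerUpToFive` holds. [folklore] -/
theorem kyCannotSeparatePaddedPerUpToFive_holds : KYCannotSeparatePaddedPerUpToFive := by
  intro m n _ hm hmn p k
  by_cases h9 : 3 * m + 2 ≤ 2 * n
  · exact kyCannotSeparatePaddedPerSharperEveryM_holds m n h9 p k
  interval_cases m
  · omega
  · obtain rfl : n = 2 := by omega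
    exact KYCellsLT2.kyRank_paddedPerOne_le_detTwo p k
  · obtain rfl : n = 3 := by omega
    exact KYCellsLT2.kyRank_paddedPerTwo_le_detThree p k
  · exact kyCannotSeparatePaddedPerThree_holds n (by omega) p k
  · exact kyCannotSeparatePaddedPerFourFromFive_holds n (by omega) p k
  · exact kyCannotSeparatePaddedPerFiveFromSix_holds n (by omega) p k

end Summit.PneNP.GCT
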